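import Summits.BirchSwinnertonDyer.BirchSwinnertonDyer.Theorems.CyclotomicUntwistConjugateGrossZagier
import Literature.NumberTheory.EllipticCurves.CuspFormLFunctionLevelConductorProofs
import HarnessLib

/-!
# D1 at curve level WITHOUT Carayol: the hidden newform of `IsPSCyclotomicLFunctionOf W η α μ` is ANY newform
# of `W` (strong multiplicity one across levels), so `𝓛^η_W` is UNIQUE unconditionally, and the
# candidate / conjugation package of the route holds with the `hlev` binder deleted

Cell `pub/bsd-wall` (D-0145 line `route-BirchSwinnertonDyer-CyclotomicUntwist` rev 9), seat `bsd-line-cycu-p3`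
(prover seat 3/3, gen 11). THEOREMS ONLY (no definition, no named fact, no `sorry`); helper `--supports`
K1 = stmt-BirchSwinnertonDyer-21580 (serves K2 = 21581 and C4 27546 / C5 identically). BSD is not proved by this
file and no crux of the route is proved by it; K1/K2 stay open and WHOLE.

WHY. D1's curve-level predicate `IsPSCyclotomicLFunctionOf W η α μ := ∃ N f, IsNewformOf W f ∧
IsUntwistedPAdicLFunction 3 f η α μ` hides the newform behind an existential. Every curve-level consumer that
must IDENTIFY the hidden newform of two witnesses (uniqueness `PSGammaUniqueness.eq_of_isPSCyclotomicLFunctionOf`,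
the candidate identification `PSCandidateUniqueness.eq_candidate_of_isPSCyclotomicLFunctionOf` /
`exists_isPSCyclotomicLFunctionOf_iff_hasGrowthOrder_candidate` / `eq_map_candidate_of_isPSCyclotomicLFunctionOf`,
the conjugation package `PSConjugateLFunctionsThree.eq_conj_of_isPSCyclotomicLFunctionOf` /
`conjugate_invariants_of_isPSCyclotomicLFunctionOf`, `PSAmiceRationality.conj_gammaMahlerCoeff_of_isPSCyclotomicLFunctionOf`,
`PSConjugateGrossZagier.conj_transfer_of_isPSCyclotomicLFunctionOf`) was filed CONDITIONAL on Carayol's level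
theorem `hlev : ∀ M, IsNewformOf.level_eq_conductorNorm (N := M)` (a named print fact), used only as
`N = N_W = N'`. But two newforms OF THE SAME CURVE have the same level UNCONDITIONALLY — the tree's
`IsNewformOf.level_eq_level` (`CuspFormLFunctionLevelConductorProofs`; Atkin–Lehner 1970 Thm. 4 = the tree's
theorem `IsNewform0.level_eq_of_heckeEigenvalue_eq_holds`, both newforms carrying `a_p(W)` at every prime) —
and then coincide (`IsNewformOf.unique`). So the binder is idle in all of them:

* §1 `isUntwistedPAdicLFunction_of_isNewformOf` — **bridge**: `IsPSCyclotomicLFunctionOf W η α μ` and ANY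
  newform `f` of `W` give `IsUntwistedPAdicLFunction 3 f η α μ`; `isPSCyclotomicLFunctionOf_iff_of_isNewformOf`.
* §2 **`eq_of_isPSCyclotomicLFunctionOf`** — `𝓛^η_W` is UNIQUE: two witnesses of `IsPSCyclotomicLFunctionOf W η α`
  are equal, NO hypothesis (was: granted `hlev`).
* §3 the candidate statements of `PSCandidateUniqueness` §1b/§3 at curve level without `hlev`
  (`eq_candidate_of_isPSCyclotomicLFunctionOf`, `exists_isPSCyclotomicLFunctionOf_iff_hasGrowthOrder_candidate`,
  `eq_map_candidate_of_isPSCyclotomicLFunctionOf`; same binders otherwise, verbatim).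
* §4 the conjugation package without `hlev`: `eq_conj_of_isPSCyclotomicLFunctionOf` (`𝓛^{η̄}_W = σ ∘ 𝓛^{η}_W`),
  `conj_gammaMahlerCoeff_of_isPSCyclotomicLFunctionOf`, `conjugate_invariants_of_isPSCyclotomicLFunctionOf`,
  `conj_transfer_of_isPSCyclotomicLFunctionOf` (GZ₃ / pBSD₃ transfer to ANY conjugate untwisted `L`-function).

Companion: `CyclotomicUntwistC1OfPrintFive` (same seat) — where the level `N = N_W` itself is wanted, `hlev` is a
theorem granted modularity (`PSC1OfPrintFive.level_eq_conductorNorm_of_modularity`). After the two files no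
theorem of the route needs `IsNewformOf.level_eq_conductorNorm` as an input.

References: [cite: AtkinLehner1970, Thm. 4] · [cite: MazurTateTeitelbaum1986Invent, §I.10–§I.11 and §I.13–§I.14] ·
[cite: Bellaiche2021, Thm. 6.2.13 (i) and Thm. 6.7.9] · [cite: Benois2020, §0.3].
-/

noncomputable section

open scoped MatrixGroups

open Filter Topology CongruenceSubgroup DirichletCharacter WeierstrassCurve Literature.NumberTheory.EllipticCurves
  Literature.NumberTheory.EllipticCurves.ModularForms Literature.NumberTheory.IwasawaTheory
  Summit.BirchSwinnertonDyer.BirchSwinnertonDyer.Theorems.PSF1Reduction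
  Summit.BirchSwinnertonDyer.BirchSwinnertonDyer.Theorems.PSGammaUniqueness
  Summit.BirchSwinnertonDyer.BirchSwinnertonDyer.Theorems.PSCandidateUniqueness
  Summit.BirchSwinnertonDyer.BirchSwinnertonDyer.Theorems.PSConjugateLFunctions
  Summit.BirchSwinnertonDyer.BirchSwinnertonDyer.Theorems.PSConjugateLFunctionsThree
  Summit.BirchSwinnertonDyer.BirchSwinnertonDyer.Theorems.PSAmiceRationality
  Summit.BirchSwinnertonDyer.BirchSwinnertonDyer.Theorems.PSConjugateGrossZagier

-- single-conjunct summit: `Summit.BirchSwinnertonDyer.BirchSwinnertonDyer.…` repeats the name by design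
set_option linter.dupNamespace false
set_option autoImplicit false

namespace Summit.BirchSwinnertonDyer.BirchSwinnertonDyer.Theorems.PSD1NewformBridge

/-! ### §1 The bridge: the hidden newform is any newform of `W` -/

/-- **Bridge (unconditional).** If `μ` is a principal-series cyclotomic `3`-adic `L`-function of `W` for the
datum `(η, α)` (`IsPSCyclotomicLFunctionOf`, newform hidden behind `∃`) and `f` is ANY newform of `W` at any
level, then `μ` has the D1 property for `f`: the hidden newform `f'` has the level of `f`
(`IsNewformOf.level_eq_level`, Atkin–Lehner's strong multiplicity one across levels) and equals `f`
(`IsNewformOf.unique`). [cite: AtkinLehner1970, Thm. 4] [cite: MazurTateTeitelbaum1986Invent, §I.14] -/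
theorem isUntwistedPAdicLFunction_of_isNewformOf {W : WeierstrassCurve ℚ}
    {η : DirichletCharacter ℂ_[3] (3 ^ 2)} {α : ℂ_[3]} {μ : (n : ℕ) → ZMod (3 ^ n) → ℂ_[3]}
    (hμ : IsPSCyclotomicLFunctionOf W η α μ) {N : ℕ} [NeZero N] {f : CuspForm (Gamma0 N) 2}
    (hf : IsNewformOf W f) : IsUntwistedPAdicLFunction 3 f η α μ := by
  obtain ⟨N', _, f', hf', hL'⟩ := hμ
  obtain rfl : N = N' := hf.level_eq_level hf'
  obtain rfl : f = f' := hf.unique hf'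
  exact hL'

/-- **D1 at curve level ⟺ D1 for any given newform of the curve** (unconditional).
[cite: AtkinLehner1970, Thm. 4] [cite: MazurTateTeitelbaum1986Invent, §I.14] -/
theorem isPSCyclotomicLFunctionOf_iff_of_isNewformOf {W : WeierstrassCurve ℚ}
    {η : DirichletCharacter ℂ_[3] (3 ^ 2)} {α : ℂ_[3]} {μ : (n : ℕ) → ZMod (3 ^ n) → ℂ_[3]}
    {N : ℕ} [NeZero N] {f : CuspForm (Gamma0 N) 2} (hf : IsNewformOf W f) :
    IsPSCyclotomicLFunctionOf W η α μ ↔ IsUntwistedPAdicLFunction 3 f η α μ :=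
  ⟨fun hμ ↦ isUntwistedPAdicLFunction_of_isNewformOf hμ hf, fun h ↦ ⟨N, inferInstance, f, hf, h⟩⟩

/-! ### §2 Uniqueness of `𝓛^η_W`, unconditional -/

/-- **Uniqueness of the principal-series cyclotomic `3`-adic `L`-function `𝓛^η_W` — UNCONDITIONAL.** Two ball
systems with `IsPSCyclotomicLFunctionOf W η α` are equal: by the bridge both have the D1 property for the same
newform, and `PSGammaUniqueness.eq_of_isUntwistedPAdicLFunction` (Višik uniqueness in the ball-value currency,
no growth needed) applies. Supersedes the `hlev`-conditional `PSGammaUniqueness.eq_of_isPSCyclotomicLFunctionOf`.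
[cite: Bellaiche2021, Thm. 6.2.13 (i)] [cite: AtkinLehner1970, Thm. 4] [cite: MazurTateTeitelbaum1986Invent, §I.14] -/
theorem eq_of_isPSCyclotomicLFunctionOf {W : WeierstrassCurve ℚ} {η : DirichletCharacter ℂ_[3] (3 ^ 2)}
    {α : ℂ_[3]} {μ μ' : (n : ℕ) → ZMod (3 ^ n) → ℂ_[3]} (h : IsPSCyclotomicLFunctionOf W η α μ)
    (h' : IsPSCyclotomicLFunctionOf W η α μ') : μ = μ' := by
  obtain ⟨N, _, f, hf, hL⟩ := h
  exact eq_of_isUntwistedPAdicLFunction hL (isUntwistedPAdicLFunction_of_isNewformOf h' hf)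

/-- At most one ball system is `𝓛^η_W` (subsingleton form). [cite: Bellaiche2021, Thm. 6.2.13 (i)] -/
theorem subsingleton_isPSCyclotomicLFunctionOf (W : WeierstrassCurve ℚ) (η : DirichletCharacter ℂ_[3] (3 ^ 2))
    (α : ℂ_[3]) : Subsingleton {μ : (n : ℕ) → ZMod (3 ^ n) → ℂ_[3] // IsPSCyclotomicLFunctionOf W η α μ} :=
  ⟨fun a b ↦ Subtype.ext (eq_of_isPSCyclotomicLFunctionOf a.2 b.2)⟩

/-! ### §3 The candidate statements at curve level, without `hlev` -/

section Curve

variable {W : WeierstrassCurve ℚ} {N : ℕ} [NeZero N] {f : CuspForm (Gamma0 N) 2}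
variable (η : DirichletCharacter ℂ_[3] (3 ^ 2)) (α : ℂ_[3])
variable (S : (j : ℕ) → ZMod (3 ^ j) → ℂ_[3])
variable (hS : ∀ (j : ℕ) (y : ZMod (3 ^ j)), S j y = ∑ b : ZMod (3 ^ 2), η b *
  algebraMap ℚ ℂ_[3] (ratPlusSymbol f ((y.val : ℚ) / (3 : ℚ) ^ j + (b.val : ℚ) / (3 : ℚ) ^ 2)))
variable (ν : (M : ℕ) → ZMod (3 ^ M) → ℂ_[3])
variable (hν : ∀ (M : ℕ) (x : ZMod (3 ^ M)), ν M x =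
  (∑ i ∈ Finset.range M, α⁻¹ ^ (i + 1) * (((3 : ℕ) : ℂ_[3]) ^ (i + 1) / ((3 : ℕ) : ℂ_[3]) ^ M) *
      S (i + 1) ((x.val : ℕ) : ZMod (3 ^ (i + 1)))) +
    (((3 : ℕ) : ℂ_[3]) ^ M)⁻¹ * (1 - α / (3 : ℕ))⁻¹ * S 0 0)
variable (ρ : (M : ℕ) → ZMod (3 ^ M) → ℂ_[3])
variable (hρ : ∀ (M : ℕ) (y : ZMod (3 ^ M)), ρ M y = η⁻¹ ((y.val : ℕ) : ZMod (3 ^ 2)) * ν M y)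
variable (𝓛 : (n : ℕ) → ZMod (3 ^ n) → ℂ_[3])
variable (h𝓛 : ∀ (n : ℕ) (s : ZMod (3 ^ n)), 𝓛 n s =
  ∑ᶠ T : rootsOfUnity (torsionOrder 3) ℤ_[3],
    ∑ y ∈ Finset.univ.filter (fun y : ZMod (3 ^ (2 + cyclotomicExponent 3 + n)) ↦
      ZMod.castHom (pow_dvd_pow 3 (by omega : cyclotomicExponent 3 + n ≤ 2 + cyclotomicExponent 3 + n))
          (ZMod (3 ^ (cyclotomicExponent 3 + n))) y =
        PadicInt.toZModPow (cyclotomicExponent 3 + n) ((T : ℤ_[3]ˣ) : ℤ_[3]) *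
          (cyclotomicGenerator 3 : ZMod (3 ^ (cyclotomicExponent 3 + n))) ^ s.val),
      ρ (2 + cyclotomicExponent 3 + n) y)

include hS hν hρ h𝓛 in
/-- **`𝓛^η_W` is the candidate — unconditional**: every `μ` with `IsPSCyclotomicLFunctionOf W η α μ` equals the
explicit Mazur–Tate–Teitelbaum candidate built on ANY newform `f` of `W` (`η` primitive mod `9`, `α ∉ {0, 3}`);
`PSCandidateUniqueness.eq_candidate_of_isPSCyclotomicLFunctionOf` with its Carayol binder deleted.
[cite: MazurTateTeitelbaum1986Invent, §I.14 (case p ∣ N)] [cite: AtkinLehner1970, Thm. 4] -/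
theorem eq_candidate_of_isPSCyclotomicLFunctionOf
    (hf : IsNewformOf W f) (hη : η.IsPrimitive) (hα : α ≠ 0) (hα3 : α ≠ (3 : ℕ))
    {μ : (n : ℕ) → ZMod (3 ^ n) → ℂ_[3]} (hμ : IsPSCyclotomicLFunctionOf W η α μ) : μ = 𝓛 :=
  eq_candidate_of_isUntwistedPAdicLFunction (p := 3) f η α S hS ν hν ρ hρ 𝓛 h𝓛 (by norm_num) hη hα hα3
    (isUntwistedPAdicLFunction_of_isNewformOf hμ hf)

include hS hν hρ h𝓛 in
/-- **F1 for the curve ⟺ growth of the candidate — unconditional**: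
`(∃ μ, IsPSCyclotomicLFunctionOf W η α μ) ↔ HasGrowthOrder 3 ½ 𝓛` for any newform `f` of `W`, `η` primitive mod
`9`, `α ∉ {0, 3}` (`PSCandidateUniqueness.exists_isPSCyclotomicLFunctionOf_iff_hasGrowthOrder_candidate` without
`hlev`). [cite: MazurTateTeitelbaum1986Invent, §I.14 (case p ∣ N)] [cite: Bellaiche2021, Thm. 6.2.13] -/
theorem exists_isPSCyclotomicLFunctionOf_iff_hasGrowthOrder_candidate
    (hf : IsNewformOf W f) (hη : η.IsPrimitive) (hα : α ≠ 0) (hα3 : α ≠ (3 : ℕ)) :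
    (∃ μ : (n : ℕ) → ZMod (3 ^ n) → ℂ_[3], IsPSCyclotomicLFunctionOf W η α μ) ↔
      HasGrowthOrder 3 (1 / 2) 𝓛 := by
  refine ⟨fun ⟨μ, hμ⟩ ↦ ?_, fun h ↦ ⟨𝓛, PSF1Curve.isPSCyclotomicLFunctionOf_of_hasGrowthOrder η α S hS ν hν
    ρ hρ 𝓛 h𝓛 hf hη hα hα3 h⟩⟩
  rw [← eq_candidate_of_isPSCyclotomicLFunctionOf η α S hS ν hν ρ hρ 𝓛 h𝓛 hf hη hα hα3 hμ]
  exact hμ.isGammaDistribution_and_hasGrowthOrder.2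

end Curve

section RationalCurve

variable {K : Type*} [Field K] (ι : K →+* ℂ_[3])
variable {W : WeierstrassCurve ℚ} {N : ℕ} [NeZero N] {f : CuspForm (Gamma0 N) 2}
variable (ηK : DirichletCharacter K (3 ^ 2)) (αK : K)
variable (SK : (j : ℕ) → ZMod (3 ^ j) → K)
variable (hSK : ∀ (j : ℕ) (y : ZMod (3 ^ j)), SK j y = ∑ b : ZMod (3 ^ 2), ηK b *
  ((ratPlusSymbol f ((y.val : ℚ) / (3 : ℚ) ^ j + (b.val : ℚ) / (3 : ℚ) ^ 2) : ℚ) : K))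
variable (νK : (M : ℕ) → ZMod (3 ^ M) → K)
variable (hνK : ∀ (M : ℕ) (x : ZMod (3 ^ M)), νK M x =
  (∑ i ∈ Finset.range M, αK⁻¹ ^ (i + 1) * (((3 : ℕ) : K) ^ (i + 1) / ((3 : ℕ) : K) ^ M) *
      SK (i + 1) ((x.val : ℕ) : ZMod (3 ^ (i + 1)))) +
    (((3 : ℕ) : K) ^ M)⁻¹ * (1 - αK / (3 : ℕ))⁻¹ * SK 0 0)
variable (ρK : (M : ℕ) → ZMod (3 ^ M) → K)
variable (hρK : ∀ (M : ℕ) (y : ZMod (3 ^ M)), ρK M y = ηK⁻¹ ((y.val : ℕ) : ZMod (3 ^ 2)) * νK M y)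
variable (𝓛K : (n : ℕ) → ZMod (3 ^ n) → K)
variable (h𝓛K : ∀ (n : ℕ) (s : ZMod (3 ^ n)), 𝓛K n s =
  ∑ᶠ T : rootsOfUnity (torsionOrder 3) ℤ_[3],
    ∑ y ∈ Finset.univ.filter (fun y : ZMod (3 ^ (2 + cyclotomicExponent 3 + n)) ↦
      ZMod.castHom (pow_dvd_pow 3 (by omega : cyclotomicExponent 3 + n ≤ 2 + cyclotomicExponent 3 + n))
          (ZMod (3 ^ (cyclotomicExponent 3 + n))) y =
        PadicInt.toZModPow (cyclotomicExponent 3 + n) ((T : ℤ_[3]ˣ) : ℤ_[3]) *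
          (cyclotomicGenerator 3 : ZMod (3 ^ (cyclotomicExponent 3 + n))) ^ s.val),
      ρK (2 + cyclotomicExponent 3 + n) y)

include hSK hνK hρK h𝓛K in
/-- **`𝓛^η_W = ι ∘ 𝓛_K` — unconditional** (`PSCandidateUniqueness.eq_map_candidate_of_isPSCyclotomicLFunctionOf`
without `hlev`): for any newform `f` of `W`, a coefficient field `K` with `ι : K →+* ℂ₃`, `η_K` primitive mod `9`,
`ι α_K ∉ {0, 3}`, every `μ` with `IsPSCyclotomicLFunctionOf W (η_K.ringHomComp ι) (ι α_K) μ` is `ι ∘ 𝓛_K`.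
[cite: MazurTateTeitelbaum1986Invent, §I.10 and §I.14] [cite: AtkinLehner1970, Thm. 4] -/
theorem eq_map_candidate_of_isPSCyclotomicLFunctionOf
    (hf : IsNewformOf W f) (hη : ηK.IsPrimitive) (hα : ι αK ≠ 0) (hα3 : ι αK ≠ (3 : ℕ))
    {μ : (n : ℕ) → ZMod (3 ^ n) → ℂ_[3]} (hμ : IsPSCyclotomicLFunctionOf W (ηK.ringHomComp ι) (ι αK) μ) :
    μ = fun n s ↦ ι (𝓛K n s) :=
  eq_map_candidate_of_isUntwistedPAdicLFunction (p := 3) ι f ηK αK SK hSK νK hνK ρK hρK 𝓛K h𝓛K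
    (by norm_num) hη hα hα3 (isUntwistedPAdicLFunction_of_isNewformOf hμ hf)

end RationalCurve

/-! ### §4 The conjugation package, without `hlev` -/

section Conjugation

variable {W : WeierstrassCurve ℚ}
  (ι : CyclotomicField 3 ℚ_[3] →ₐ[ℚ_[3]] ℂ_[3])
  (ηK : DirichletCharacter (CyclotomicField 3 ℚ_[3]) (3 ^ 2)) (αK : CyclotomicField 3 ℚ_[3])
  (σ : CyclotomicField 3 ℚ_[3] ≃ₐ[ℚ_[3]] CyclotomicField 3 ℚ_[3])

/-- **`𝓛^{η̄}_W = σ ∘ 𝓛^{η}_W` — unconditional** (`PSConjugateLFunctionsThree.eq_conj_of_isPSCyclotomicLFunctionOf`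
without `hlev`): with `η_K` primitive, `η_K ∘ σ = η_K⁻¹`, `α_K ∉ {0, 3}`, if `μ` is `𝓛^{η}_W` (datum
`(η_K ∘ ι, ι α_K)`) and `μ'` is `𝓛^{η̄}_W` (datum `((η_K ∘ ι)⁻¹, ι (σ α_K))`), then `μ = ι ∘ μ_K` and
`μ' = ι ∘ σ ∘ μ_K` for one `ℚ₃(ζ₃)`-valued `μ_K`. [cite: MazurTateTeitelbaum1986Invent, §I.10 and §I.14]
[cite: AtkinLehner1970, Thm. 4] -/
theorem eq_conj_of_isPSCyclotomicLFunctionOf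
    (hσ : ηK.ringHomComp (σ : CyclotomicField 3 ℚ_[3] →+* CyclotomicField 3 ℚ_[3]) = ηK⁻¹)
    (hη : ηK.IsPrimitive) (hα : αK ≠ 0) (hα3 : αK ≠ (3 : ℕ))
    {μ μ' : (n : ℕ) → ZMod (3 ^ n) → ℂ_[3]}
    (hμ : IsPSCyclotomicLFunctionOf W (ηK.ringHomComp (ι : CyclotomicField 3 ℚ_[3] →+* ℂ_[3])) (ι αK) μ)
    (hμ' : IsPSCyclotomicLFunctionOf W (ηK.ringHomComp (ι : CyclotomicField 3 ℚ_[3] →+* ℂ_[3]))⁻¹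
      (ι (σ αK)) μ') :
    ∃ μK : (n : ℕ) → ZMod (3 ^ n) → CyclotomicField 3 ℚ_[3],
      (μ = fun n s ↦ ι (μK n s)) ∧ (μ' = fun n s ↦ ι (σ (μK n s))) := by
  obtain ⟨μK, -, -, hμK, hPS, -, -⟩ :=
    exists_conj_gammaMahlerCoeff_of_isPSCyclotomicLFunctionOf ι ηK αK σ hσ hη hα hα3 hμ
  exact ⟨μK, hμK, eq_of_isPSCyclotomicLFunctionOf hμ' hPS⟩

/-- **Any `𝓛^{η̄}_W` has the `σ`-conjugate Amice transform of `𝓛^{η}_W` — unconditional**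
(`PSAmiceRationality.conj_gammaMahlerCoeff_of_isPSCyclotomicLFunctionOf` without `hlev`): there is
`c : ℕ → ℚ₃(ζ₃)` with `c_k(μ) = ι (c k)` and `c_k(μ') = ι (σ (c k))` for every `k`.
[cite: MazurTateTeitelbaum1986Invent, §I.10 and §I.13] [cite: AtkinLehner1970, Thm. 4] -/
theorem conj_gammaMahlerCoeff_of_isPSCyclotomicLFunctionOf
    (hσ : ηK.ringHomComp (σ : CyclotomicField 3 ℚ_[3] →+* CyclotomicField 3 ℚ_[3]) = ηK⁻¹)
    (hη : ηK.IsPrimitive) (hα : αK ≠ 0) (hα3 : αK ≠ (3 : ℕ))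
    {μ μ' : (n : ℕ) → ZMod (3 ^ n) → ℂ_[3]}
    (hμ : IsPSCyclotomicLFunctionOf W (ηK.ringHomComp (ι : CyclotomicField 3 ℚ_[3] →+* ℂ_[3])) (ι αK) μ)
    (hμ' : IsPSCyclotomicLFunctionOf W (ηK.ringHomComp (ι : CyclotomicField 3 ℚ_[3] →+* ℂ_[3]))⁻¹
      (ι (σ αK)) μ') :
    ∃ c : ℕ → CyclotomicField 3 ℚ_[3], ∀ k : ℕ,
      gammaMahlerCoeff 3 μ k = ι (c k) ∧ gammaMahlerCoeff 3 μ' k = ι (σ (c k)) := by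
  obtain ⟨μK, c, -, -, hPS, hc, -⟩ :=
    exists_conj_gammaMahlerCoeff_of_isPSCyclotomicLFunctionOf ι ηK αK σ hσ hη hα hα3 hμ
  obtain rfl : μ' = fun n s ↦ ι (σ (μK n s)) := eq_of_isPSCyclotomicLFunctionOf hμ' hPS
  exact ⟨c, hc⟩

/-- **Conjugate `L`-functions share their invariants — unconditional**
(`PSConjugateLFunctionsThree.conjugate_invariants_of_isPSCyclotomicLFunctionOf` without `hlev`): for
`μ = 𝓛^{η}_W` and `μ' = 𝓛^{η̄}_W` as above — equal norms of ball values and of all Mahler coefficients, the same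
order of vanishing at `𝟙` and the same leading norm (`ι` and `ι ∘ σ` induce the same norm on `ℚ₃(ζ₃)`,
`PSConjugateGrossZagier.norm_map_conj`). [cite: MazurTateTeitelbaum1986Invent, §I.10 and §I.13–§I.14]
[cite: BoschGuntzerRemmert1984, §3.2.4 Thm. 2] -/
theorem conjugate_invariants_of_isPSCyclotomicLFunctionOf
    (hσ : ηK.ringHomComp (σ : CyclotomicField 3 ℚ_[3] →+* CyclotomicField 3 ℚ_[3]) = ηK⁻¹)
    (hη : ηK.IsPrimitive) (hα : αK ≠ 0) (hα3 : αK ≠ (3 : ℕ))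
    {μ μ' : (n : ℕ) → ZMod (3 ^ n) → ℂ_[3]}
    (hμ : IsPSCyclotomicLFunctionOf W (ηK.ringHomComp (ι : CyclotomicField 3 ℚ_[3] →+* ℂ_[3])) (ι αK) μ)
    (hμ' : IsPSCyclotomicLFunctionOf W (ηK.ringHomComp (ι : CyclotomicField 3 ℚ_[3] →+* ℂ_[3]))⁻¹
      (ι (σ αK)) μ') :
    (∀ (n : ℕ) (s : ZMod (3 ^ n)), ‖μ' n s‖ = ‖μ n s‖) ∧
      (∀ k : ℕ, ‖gammaMahlerCoeff 3 μ' k‖ = ‖gammaMahlerCoeff 3 μ k‖) ∧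
      gammaOrderAtOne 3 μ' = gammaOrderAtOne 3 μ ∧ ‖gammaLeadingCoeff 3 μ'‖ = ‖gammaLeadingCoeff 3 μ‖ := by
  obtain ⟨μK, c, ℓ, hμK, hPS, hc, hord, hℓ, hℓ'⟩ :=
    exists_conj_gammaMahlerCoeff_of_isPSCyclotomicLFunctionOf ι ηK αK σ hσ hη hα hα3 hμ
  obtain rfl : μ' = fun n s ↦ ι (σ (μK n s)) := eq_of_isPSCyclotomicLFunctionOf hμ' hPS
  refine ⟨fun n s ↦ ?_, fun k ↦ ?_, hord, ?_⟩
  · rw [hμK]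
    exact norm_map_conj ι σ (μK n s)
  · rw [(hc k).1, (hc k).2]
    exact norm_map_conj ι σ (c k)
  · rw [hℓ, hℓ']
    exact norm_map_conj ι σ ℓ

/-- **GZ₃ / pBSD₃ transfer to ANY conjugate untwisted `L`-function — unconditional**
(`PSConjugateGrossZagier.conj_transfer_of_isPSCyclotomicLFunctionOf` without `hlev`): for `μ = 𝓛^{η}_W` and
`μ' = 𝓛^{η̄}_W` (root `σ α`), GZ₃ and pBSD₃ for `(μ, ψ)` imply GZ₃ and pBSD₃ for `(μ', ψ ∘ σ)` with the constant
conjugated. [cite: MazurTateTeitelbaum1986Invent, §I.10 and §I.13] [cite: Benois2020, §0.3] -/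
theorem conj_transfer_of_isPSCyclotomicLFunctionOf
    (hσ : ηK.ringHomComp (σ : CyclotomicField 3 ℚ_[3] →+* CyclotomicField 3 ℚ_[3]) = ηK⁻¹)
    (hη : ηK.IsPrimitive) (hα : αK ≠ 0) (hα3 : αK ≠ (3 : ℕ))
    {μ μ' : (n : ℕ) → ZMod (3 ^ n) → ℂ_[3]}
    (hμ : IsPSCyclotomicLFunctionOf W (ηK.ringHomComp (ι : CyclotomicField 3 ℚ_[3] →+* ℂ_[3])) (ι αK) μ)
    (hμ' : IsPSCyclotomicLFunctionOf W (ηK.ringHomComp (ι : CyclotomicField 3 ℚ_[3] →+* ℂ_[3]))⁻¹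
      (ι (σ αK)) μ')
    (Dh : W.PSLineHeightData (CyclotomicField 3 ℚ_[3])) (ψ : DirichletCharacter (CyclotomicField 3 ℚ_[3]) 9)
    (P Q : W.toAffine.Point) :
    (∀ (κ : CyclotomicField 3 ℚ_[3]) (q : ℚ),
        gammaMahlerCoeff 3 μ 1 = ι κ * (q : ℂ_[3]) * ι (Dh.pairing ψ P Q) →
          gammaMahlerCoeff 3 μ' 1 = ι (σ κ) * (q : ℂ_[3]) *
            ι (Dh.pairing (ψ.ringHomComp (σ : CyclotomicField 3 ℚ_[3] →+* CyclotomicField 3 ℚ_[3])) P Q)) ∧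
      (∀ A : ℝ, ‖gammaMahlerCoeff 3 μ 1‖ = A * ‖ι (Dh.pairing ψ P Q)‖ →
        ‖gammaMahlerCoeff 3 μ' 1‖ = A *
          ‖ι (Dh.pairing (ψ.ringHomComp (σ : CyclotomicField 3 ℚ_[3] →+* CyclotomicField 3 ℚ_[3])) P Q)‖) := by
  obtain ⟨μ'', hPS, hGZ, hB⟩ := exists_conj_transfer_of_isPSCyclotomicLFunctionOf ι ηK αK σ hσ hη hα hα3 hμ
  obtain rfl : μ' = μ'' := eq_of_isPSCyclotomicLFunctionOf hμ' hPS
  exact ⟨fun κ q h ↦ hGZ Dh ψ P Q κ q h, fun A h ↦ hB Dh ψ P Q A h⟩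

end Conjugation

end Summit.BirchSwinnertonDyer.BirchSwinnertonDyer.Theorems.PSD1NewformBridge

end
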